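import Summits.ABC.IUTFork.Conditional.AbcOfSlotLicenceGenuineKRead
import Summits.ABC.IUTFork.Cor312SlotHullJunctionK
import Summits.ABC.IUTFork.LDHGenuinePerImageSufficiencyPoint
import HarnessLib

/-!
# Branch C, K line, READING (P) — the DOWNSTREAM STATEMENT line θ-CUT with READ 0 (explicit 1 = the typed Cor. 3.12 in reading (P) on the
# content locus), and WHERE that hypothesis is a THEOREM: the typed statement (both readings) at every genuine datum of a nonarch-Szpiro-good point

C scoreboard, R2 S-chain team (abc-iut-s2-p10 gen 9; statement-line lineage p444732 / p447155 / p449259 / p455513 / p460839 / p461940). PROOF-ONLY (no `def`,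
no new `Prop`, no instance; §0 DATA = abc-iut-C-cert-2's p458998 / p462946 VERBATIM; hypothesis texts VERBATIM up to the documented antecedent). BY NAME: abc-iut-C-cert-2
`Cor312.Setting.SlotStatement` / `SlotLicence` (p458847), `GenuineKSlot.cor312PerImageOf_of_slotStatement`, `abc_of_slotStatement_genuineK_szpiroBad(_read)`,
`abc_of_slotLicence_orNumP_K_content_read` (p458998 / p462946); abc-iut-C-cert-1 `ABC_of_cor312PerImage_content` (p461361); abc-iut-s2-p7 the
Θ-side READ-P `negLogThetaSlot_settingPrVolSharp_pilotDataOfK_chosen_le_datum` (p462377; nonarch side an EQUALITY p462135); abc-iut-s2-p2 the readout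
`slotStatement_settingPrVolSharp_pilotDataOfK_chosen_readout` (`SlotStatement ↔ T.I.Cor312PerImageNonarchOf`, `SlotStatement → Statement`);
abc-iut-c312-d1 `GenuineContent.neg_ndegLgp_add_mul_ndeg_le_negLogThetaPerImageNonarch` / `…cor312PerImageOf_of_le_logDiff_logCond` (p446147).

* §1 NONARCHIMEDEAN SUFFICIENCY (abc-iut-c312-d1's part B WITHOUT the archimedean slack `((l+5)/4)·log π`): `GenuineContent.cor312PerImageNonarchOf_of_le_mul_ndeg`
  (input, `K/F₀` Galois); `…_of_le_logDiff_logCond` — at a genuine datum `T` of `(P, l)` (`λ ∈ U_X`, `l ≥ 1`, `d_mod ≤ (l+5)/4`):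
  `((l+1)/24 − 1/(2l))·log q^{∤{2,l}}(λ) ≤ ((l+5)/4 − d_mod)·(log-diff(λ) + (1 − 1/l)·log 𝔣^{∤{2,l}}(λ)) ⟹ T.Cor312PerImageNonarchOf`; Szpiro form
  `…_of_szpiroNonarch` (`l ≥ 5`): `log q^{∤2l} ≤ (6l(l+5−4d_mod)/((l+4)(l−3)))·(log-diff + (1 − 1/l)·log-cond)`.
* §2 THE STATEMENT-LINE HYPOTHESES ARE THEOREMS THERE: `GenuineKSlot.slotStatement_chosen_of_le_logDiff_logCond` / `…_of_szpiroNonarch` — the typed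
  [IUTchIII] Cor. 3.12 IN READING (P), `SlotStatement` of abc-iut-c312-7's sharp `K`-setting at the CHOSEN realising ideles (LITERALLY the setting term of
  `hstPBad` p458998 / p462946 and of `hstBad` / `hstC` of the (U) statement lines p455513 / p460839 / p461940), HOLDS at every genuine datum of such a
  point; `GenuineKSlot.statement_chosen_of_le_logDiff_logCond` — so does the reading-(U) `Statement`. NUMBERS (no side): p462946's `hstPBad` is DEMANDED
  at `log q^{∤2l} > (6l(l+5−4d_mod)/((l+4)(l−3)))·(…) + (6l(l+5)/((l+4)(l−3)))·log π` and is a THEOREM at `log q^{∤2l} ≤ (6l(l+5−4d_mod)/((l+4)(l−3)))·(…)`: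
  the two loci are separated by EXACTLY the archimedean strip `(6l(l+5)/((l+4)(l−3)))·log π` (`< 10.4` nats for `l ≥ 11`); in and above the strip
  nothing is decided here (abc-iut-c312-d1's necessity `PointDict.szpiro_of_cor312PerImageAtDatum_tame_six` bites only above `≈ 12·(log-diff + log-cond) + 390`
  at `l = 13`). §3 `GenuineKSlot.cor312PerImageOf_of_slotStatement_read` — per datum, READ 0: `SlotStatement ⊢ T.Cor312PerImageOf`.
* §4 `abc_of_slotStatement_genuineK_content_offLicence_read` — `ABC` from ONE hypothesis `hstPOffC` «`SlotStatement` at every admissible `(P, l)` ON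
  THE CONTENT LOCUS of [IUTchIV] Thm. 1.10's display and every genuine `T` there at which OUR slot licence FAILS»; `abc_of_slotStatement_genuineK_content_read`
  (`hstPC`: at every `T`). Explicit 1; CONE 0 · READ 0 · PIN 0 · SIDE 0 · S_H 0 — the θ-cut twins of abc-iut-C-cert-2's `…_szpiroBad_read`.

HONEST STRENGTH (numbers, no side). (1) Both §4 certificates are WEAKER-OR-EQUAL THEOREMS than the γ-θ companion `abc_of_slotLicence_orNumP_K_content_read`
(`hNumPOffC ⊢ ABC`, p462946): per datum `SlotStatement ⟹ T.Cor312PerImageOf` (§3) and not conversely (archimedean slack `((l+5)/4)·log π`), so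
`hstPOffC` demands more than `hNumPOffC` at the same points; their purpose is that the single hypothesis is the S-chain's OWN typed object. (2) `hstPOffC` /
`hstPC` demand nothing at any `(P, l)` with `log q^{∤{2,l}}(λ) ≤ 120·d*_mod·l` (`d*_mod = 2¹²·3³·5·d_mod`), hence at no known or tabulated datum
(`log q < 10⁴` there); by §2 the same typed statement is TRUE by theorem on the nonarch-Szpiro-good locus, disjoint from the content locus. (3) Reading
(P) is STRONGER than print's hull of the union (abc-iut-C-cert-2 `Cor312SlotHull`; = (U) exactly at slot-constant data, abc-iut-s2-p2). Nothing here asserts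
that abc is proved or refuted, that [IUTchIII] Cor. 3.12 / [IUTchIV] Thm. 1.10 holds or fails at any datum off §2's locus, or takes a side on any author
or on (U)/(P); a cut discharges nothing; typed ≠ proved; instantiated ≠ endorsed.
[claim: Mochizuki2012, status: disputed] [cite: Mochizuki2012, IUTchIII Cor. 3.12 p. 173–174, proof Step (x) p. 181, Step (xi-f) p. 184]
[cite: Mochizuki2012, IUTchIV Thm. 1.10 Step (ii) p. 24, Step (v) p. 27–29, Step (vii)–(viii) p. 30; Cor. 2.2 (ii) proof p. 46] [cite: DupuyHilado2025, §1 (1.1), §3.3, §4.11–4.12]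
-/

noncomputable section

open Set Function NumberField IsDedekindDomain

/-! ## §1 Nonarchimedean sufficiency: Dupuy–Hilado's (1.1) per image WITHOUT the archimedean slack -/

namespace Summit.ABC.IUTFork.GenuineContent

open Literature.IUT.LogVolume Literature.NumberTheory.NumberFields Literature.IUT.HodgeTheaters
open Literature.NumberTheory.DiophantineGeometry.GenEll

section Galois

variable {F₀ : Type} [Field F₀] [NumberField F₀] {K : Type} [Field K] [NumberField K] [Algebra F₀ K]
variable (I : ThetaVolumeInput F₀ K)

/-- **Input level, `K/F₀` Galois: Cor. 3.12 IN READING (P), NONARCHIMEDEAN FORM (`I.Cor312PerImageNonarchOf`, Dupuy–Hilado's (1.1) per image) holds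
whenever `((l+1)/24 − 1/(2l))·deĝ̲(𝔮) ≤ ((ℓ⋇+3)/2 − [F₀:ℚ])·log(𝔡^K)`** — abc-iut-c312-d1's `cor312PerImageOf_of_le_mul_ndeg` with the archimedean
summand `((l+5)/4)·log π` not spent. No side taken on the claim for ALL data. [cite: Mochizuki2012, IUTchIII Cor. 3.12 p. 173–174; proof Step (x) p. 181]
[cite: Mochizuki2012, IUTchIV Thm. 1.10 Step (v) p. 27–29] [cite: DupuyHilado2025, §1 (1.1), §3.3] [claim: Mochizuki2012, status: disputed] -/
theorem cor312PerImageNonarchOf_of_le_mul_ndeg [IsGalois F₀ K]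
    (h : (((I.X.l : ℝ) + 1) / 24 - 1 / (2 * (I.X.l : ℝ))) * FinDivisor.ndeg F₀ I.X.qDivisor ≤
      (((I.X.lstar : ℝ) + 3) / 2 - Module.finrank ℚ F₀) * ndeg K (differentDivisor K)) :
    I.Cor312PerImageNonarchOf := by
  -- adapted from abc-iut-c312-d1 `GenuineContent.cor312PerImageOf_of_le_mul_ndeg` (LDHGenuinePerImageSufficiencyPoint), arch term dropped
  have hlow := neg_ndegLgp_add_mul_ndeg_le_negLogThetaPerImageNonarch I
  rw [DHData.ndegLgp_thetaPilot_eq] at hlow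
  have hq := I.negAbsLogQ_eq
  unfold ThetaVolumeInput.Cor312PerImageNonarchOf
  rw [hq]
  have hsplit : (((I.X.l : ℝ) + 1) / 24 - 1 / (2 * (I.X.l : ℝ))) * FinDivisor.ndeg F₀ I.X.qDivisor =
      ((I.X.l : ℝ) + 1) / 24 * FinDivisor.ndeg F₀ I.X.qDivisor
        - 1 / (2 * (I.X.l : ℝ)) * FinDivisor.ndeg F₀ I.X.qDivisor := sub_mul _ _ _
  change -(1 / (2 * (I.X.l : ℝ))) * FinDivisor.ndeg F₀ I.X.qDivisor ≤ I.negLogThetaPerImageNonarch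
  linarith

end Galois

variable {P : NFPoint} {l : ℕ}

/-- **PER DATUM, NONARCHIMEDEAN FORM**: for a genuine Θ-volume datum `T` at `(P, l)` (`λ ∈ U_X`, `l ≥ 1`, `d_mod ≤ (l+5)/4`),
`((l+1)/24 − 1/(2l))·log q^{∤{2,l}}(λ) ≤ ((l+5)/4 − d_mod)·(log-diff(λ) + (1 − 1/l)·log 𝔣^{∤{2,l}}(λ))` (NO `log π` term) ⟹ `T.Cor312PerImageNonarchOf`
— abc-iut-c312-d1's `Cor22.ThetaVolumeDatumAt.cor312PerImageOf_of_le_logDiff_logCond` with the archimedean slack not spent (same dictionary: `PointDict.gap_eq`,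
`[F_mod:ℚ] = d_mod`, `(ℓ⋇+3)/2 = (l+5)/4`, abc-iut-S4's Step (ii)). [cite: Mochizuki2012, IUTchIV Thm. 1.10 Step (ii) p. 24, Step (v) p. 27–29] [claim: Mochizuki2012, status: disputed] -/
theorem cor312PerImageNonarchOf_of_le_logDiff_logCond (T : Cor22.ThetaVolumeDatumAt P l) (hU : P.InU) (hl : 0 < l)
    (hd : (Cor22.dmod P : ℝ) ≤ ((l : ℝ) + 5) / 4)
    (h : (((l : ℝ) + 1) / 24 - 1 / (2 * l)) * Cor22.logQAvoid P {2, l} ≤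
      (((l : ℝ) + 5) / 4 - Cor22.dmod P) * (P.logDiff + (1 - 1 / (l : ℝ)) * Cor22.logCondAvoid P {2, l})) :
    T.Cor312PerImageNonarchOf := by
  -- adapted from abc-iut-c312-d1 `Cor22.ThetaVolumeDatumAt.cor312PerImageOf_of_le_logDiff_logCond`, arch term dropped
  letI := T.instFieldF; letI := T.instNumberFieldF; letI := T.instAlgebraF; letI := T.instFieldK
  letI := T.instNumberFieldK; letI := T.instAlgebraK; letI := T.instFieldFbar; letI := T.instAlgebraFbar
  letI := T.instAlgebraKFbar; letI := T.instIsElliptic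
  haveI := T.isGalois_fieldOfModuli_K
  have hgap := PointDict.gap_eq T hU
  have hXlN : T.I.X.l = l := T.isVolumeInputOf.l_eq
  have hXl : ((T.I.X.l : ℕ) : ℝ) = (l : ℝ) := by exact_mod_cast hXlN
  have hls : ((T.I.X.lstar : ℝ) + 3) / 2 = ((l : ℝ) + 5) / 4 := by
    have h2 : T.I.X.l = 2 * T.I.X.lstar + 1 := T.I.X.l_eq
    have h2R : ((T.I.X.l : ℕ) : ℝ) = 2 * (T.I.X.lstar : ℝ) + 1 := by exact_mod_cast h2
    rw [hXl] at h2R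
    linarith
  have hdm : (Module.finrank ℚ (fieldOfModuli T.E) : ℝ) = (Cor22.dmod P : ℝ) := by
    exact_mod_cast PointStepV.finrank_fieldOfModuli_eq_dmod T
  have hdiff := T.ndeg_differentDivisor_ge hl
  have hc : 0 ≤ ((l : ℝ) + 5) / 4 - (Cor22.dmod P : ℝ) := by linarith
  have hmono := mul_le_mul_of_nonneg_left hdiff hc
  show T.I.Cor312PerImageNonarchOf
  refine cor312PerImageNonarchOf_of_le_mul_ndeg T.I ?_
  rw [hXl, hls, hdm]
  have hg : T.gap = (((l : ℝ) + 1) / 24 - 1 / (2 * l)) * FinDivisor.ndeg (fieldOfModuli T.E) T.I.X.qDivisor := by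
    show LgpDivisor.ndegLgp T.I.X.thetaPilot - FinDivisor.ndeg _ T.I.X.qPilot = _
    rw [DHData.ndegLgp_thetaPilot_eq, PilotData.qPilot_eq_smul, map_smul, smul_eq_mul, hXl]
    ring
  rw [← hg, hgap]
  change P.logDiff + (1 - 1 / (l : ℝ)) * Cor22.logCondAvoid P {2, l} ≤ ndeg T.K (differentDivisor T.K) at hdiff
  linarith

/-- **SZPIRO FORM, NONARCHIMEDEAN** (`l ≥ 5`, `d_mod ≤ (l+5)/4`): `log q^{∤2l}(λ) ≤ (6l(l+5−4d_mod)/((l+4)(l−3)))·(log-diff(λ) +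
(1 − 1/l)·log 𝔣^{∤2l}(λ)) ⟹ T.Cor312PerImageNonarchOf` at every genuine datum `T` of `(P, l)` (divide by `κ_l = (l+4)(l−3)/(24l) > 0`).
The bound is EXACTLY the Szpiro-bad guard of the `K`-line certificates (abc-iut-c312-d1 `Cor22.forall_cor312PerImageOf_of_szpiroBad`)
minus its archimedean term `(6l(l+5)/((l+4)(l−3)))·log π`. [cite: Mochizuki2012, IUTchIV Thm. 1.10 p. 22–23; Cor. 2.2 (ii) proof p. 46]
[claim: Mochizuki2012, status: disputed] -/
theorem cor312PerImageNonarchOf_of_szpiroNonarch (T : Cor22.ThetaVolumeDatumAt P l) (hU : P.InU) (h5 : 5 ≤ l)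
    (hd : (Cor22.dmod P : ℝ) ≤ ((l : ℝ) + 5) / 4)
    (h : Cor22.logQAvoid P {2, l} ≤
      6 * l * (((l : ℝ) + 5) - 4 * Cor22.dmod P) / (((l : ℝ) + 4) * ((l : ℝ) - 3))
          * (P.logDiff + (1 - 1 / (l : ℝ)) * Cor22.logCondAvoid P {2, l})) :
    T.Cor312PerImageNonarchOf := by
  -- multiply abc-iut-c312-d1's Szpiro shape by `κ_l = (l+4)(l−3)/(24l) ≥ 0`
  have hl5 : (5 : ℝ) ≤ l := by exact_mod_cast h5
  have h4 : (l : ℝ) + 4 ≠ 0 := by linarith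
  have h3 : (l : ℝ) - 3 ≠ 0 := by linarith
  have h0 : (l : ℝ) ≠ 0 := by linarith
  refine cor312PerImageNonarchOf_of_le_logDiff_logCond T hU (by omega) hd ?_
  have hκ : ((l : ℝ) + 1) / 24 - 1 / (2 * l) = ((l : ℝ) + 4) * ((l : ℝ) - 3) / (24 * l) := by
    field_simp
    ring
  have hκ0 : 0 ≤ ((l : ℝ) + 4) * ((l : ℝ) - 3) / (24 * l) := div_nonneg (by nlinarith) (by linarith)
  have key : ((l : ℝ) + 4) * ((l : ℝ) - 3) / (24 * l) *
      (6 * l * (((l : ℝ) + 5) - 4 * Cor22.dmod P) / (((l : ℝ) + 4) * ((l : ℝ) - 3))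
        * (P.logDiff + (1 - 1 / (l : ℝ)) * Cor22.logCondAvoid P {2, l})) =
      (((l : ℝ) + 5) / 4 - Cor22.dmod P) * (P.logDiff + (1 - 1 / (l : ℝ)) * Cor22.logCondAvoid P {2, l}) := by
    field_simp
    ring
  rw [hκ, ← key]
  exact mul_le_mul_of_nonneg_left h hκ0

end Summit.ABC.IUTFork.GenuineContent

namespace Summit.ABC.IUTFork.Conditional

open Thm311 Thm311.Real Cor312 Cor312Vol Cor312Prov Literature.IUT.LogThetaLattice Literature.IUT.LogVolume
  Literature.IUT.HodgeTheaters Literature.IUT.LogVolume.ThetaData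
open Literature.NumberTheory.DiophantineGeometry.GenEll Summit.ABC.ABC.Theorems

section Family

/-! ## §0 DATA — abc-iut-C-cert-2's section variables (p458998 / p462946) VERBATIM -/
variable
    (M : ∀ (P : NFPoint) (l : ℕ) (T : Cor22.ThetaVolumeDatumAt P l), Type) [∀ P l T, Field (M P l T)] [∀ P l T, NumberField (M P l T)]
    (archPk : ∀ (P : NFPoint) (l : ℕ) (T : Cor22.ThetaVolumeDatumAt P l), letI := T.instFieldF; letI := T.instNumberFieldF; letI := T.instAlgebraF; letI := T.instFieldK;
        letI := T.instNumberFieldK; letI := T.instAlgebraK; letI := T.instFieldFbar; letI := T.instAlgebraFbar;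
        letI := T.instAlgebraKFbar; letI := T.instIsElliptic;
      ∀ (j : (thetaIndex (pilotDataOfK T.D T.K)).Label) (vQ : (thetaIndex (pilotDataOfK T.D T.K)).VQ), Set ((logShellsDH (pilotDataOfK T.D T.K) (analyticLogv T.K)).Packet j vQ))
    (archSub : ∀ (P : NFPoint) (l : ℕ) (T : Cor22.ThetaVolumeDatumAt P l), letI := T.instFieldF; letI := T.instNumberFieldF; letI := T.instAlgebraF; letI := T.instFieldK;
        letI := T.instNumberFieldK; letI := T.instAlgebraK; letI := T.instFieldFbar; letI := T.instAlgebraFbar;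
        letI := T.instAlgebraKFbar; letI := T.instIsElliptic;
      ∀ (j : (thetaIndex (pilotDataOfK T.D T.K)).Label) (v : (thetaIndex (pilotDataOfK T.D T.K)).V), Set ((logShellsDH (pilotDataOfK T.D T.K) (analyticLogv T.K)).Packet j ((thetaIndex (pilotDataOfK T.D T.K)).over v)))
    (Ψ : ∀ (P : NFPoint) (l : ℕ) (T : Cor22.ThetaVolumeDatumAt P l), letI := T.instFieldF; letI := T.instNumberFieldF; letI := T.instAlgebraF; letI := T.instFieldK;
        letI := T.instNumberFieldK; letI := T.instAlgebraK; letI := T.instFieldFbar; letI := T.instAlgebraFbar;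
        letI := T.instAlgebraKFbar; letI := T.instIsElliptic;
      ℤ → ∀ v : (thetaIndex (pilotDataOfK T.D T.K)).V, v ∈ (thetaIndex (pilotDataOfK T.D T.K)).Vbad → Set ((logShellsDH (pilotDataOfK T.D T.K) (analyticLogv T.K)).StarPacket v))
    (act : ∀ (P : NFPoint) (l : ℕ) (T : Cor22.ThetaVolumeDatumAt P l), letI := T.instFieldF; letI := T.instNumberFieldF; letI := T.instAlgebraF; letI := T.instFieldK;
        letI := T.instNumberFieldK; letI := T.instAlgebraK; letI := T.instFieldFbar; letI := T.instAlgebraFbar;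
        letI := T.instAlgebraKFbar; letI := T.instIsElliptic;
      ℤ → ∀ v : (thetaIndex (pilotDataOfK T.D T.K)).V, v ∈ (thetaIndex (pilotDataOfK T.D T.K)).Vbad → (logShellsDH (pilotDataOfK T.D T.K) (analyticLogv T.K)).StarPacket v → Module.End ℚ ((logShellsDH (pilotDataOfK T.D T.K) (analyticLogv T.K)).StarPacket v))
    (Mmod : ∀ (P : NFPoint) (l : ℕ) (T : Cor22.ThetaVolumeDatumAt P l), letI := T.instFieldF; letI := T.instNumberFieldF; letI := T.instAlgebraF; letI := T.instFieldK;
        letI := T.instNumberFieldK; letI := T.instAlgebraK; letI := T.instFieldFbar; letI := T.instAlgebraFbar;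
        letI := T.instAlgebraKFbar; letI := T.instIsElliptic;
      ℤ → ∀ j : (thetaIndex (pilotDataOfK T.D T.K)).LabelStar, Set ((logShellsDH (pilotDataOfK T.D T.K) (analyticLogv T.K)).GlobalPacket j.1))
    (region : ∀ (P : NFPoint) (l : ℕ) (T : Cor22.ThetaVolumeDatumAt P l), letI := T.instFieldF; letI := T.instNumberFieldF; letI := T.instAlgebraF; letI := T.instFieldK;
        letI := T.instNumberFieldK; letI := T.instAlgebraK; letI := T.instFieldFbar; letI := T.instAlgebraFbar;
        letI := T.instAlgebraKFbar; letI := T.instIsElliptic;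
      ℤ → ∀ j : (thetaIndex (pilotDataOfK T.D T.K)).LabelStar, FinDivisor (M P l T) → ∀ vQ : (thetaIndex (pilotDataOfK T.D T.K)).VQ, Set ((logShellsDH (pilotDataOfK T.D T.K) (analyticLogv T.K)).Packet j.1 vQ))
    (frobAdm : ∀ (P : NFPoint) (l : ℕ) (T : Cor22.ThetaVolumeDatumAt P l), letI := T.instFieldF; letI := T.instNumberFieldF; letI := T.instAlgebraF; letI := T.instFieldK;
        letI := T.instNumberFieldK; letI := T.instAlgebraK; letI := T.instFieldFbar; letI := T.instAlgebraFbar;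
        letI := T.instAlgebraKFbar; letI := T.instIsElliptic;
      ℤ → ℤ → ∀ (j : (thetaIndex (pilotDataOfK T.D T.K)).Label) (vQ : (thetaIndex (pilotDataOfK T.D T.K)).VQ), Set ((logShellsDH (pilotDataOfK T.D T.K) (analyticLogv T.K)).Packet j vQ) → Prop)
    (frobLogvol : ∀ (P : NFPoint) (l : ℕ) (T : Cor22.ThetaVolumeDatumAt P l), letI := T.instFieldF; letI := T.instNumberFieldF; letI := T.instAlgebraF; letI := T.instFieldK;
        letI := T.instNumberFieldK; letI := T.instAlgebraK; letI := T.instFieldFbar; letI := T.instAlgebraFbar;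
        letI := T.instAlgebraKFbar; letI := T.instIsElliptic;
      ℤ → ℤ → ∀ (j : (thetaIndex (pilotDataOfK T.D T.K)).Label) (vQ : (thetaIndex (pilotDataOfK T.D T.K)).VQ), Set ((logShellsDH (pilotDataOfK T.D T.K) (analyticLogv T.K)).Packet j vQ) → ℝ)
    (frobΨ : ∀ (P : NFPoint) (l : ℕ) (T : Cor22.ThetaVolumeDatumAt P l), letI := T.instFieldF; letI := T.instNumberFieldF; letI := T.instAlgebraF; letI := T.instFieldK;
        letI := T.instNumberFieldK; letI := T.instAlgebraK; letI := T.instFieldFbar; letI := T.instAlgebraFbar;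
        letI := T.instAlgebraKFbar; letI := T.instIsElliptic;
      ℤ → ℤ → ∀ v : (thetaIndex (pilotDataOfK T.D T.K)).V, v ∈ (thetaIndex (pilotDataOfK T.D T.K)).Vbad → Set ((logShellsDH (pilotDataOfK T.D T.K) (analyticLogv T.K)).StarPacket v))
    (frobMmod : ∀ (P : NFPoint) (l : ℕ) (T : Cor22.ThetaVolumeDatumAt P l), letI := T.instFieldF; letI := T.instNumberFieldF; letI := T.instAlgebraF; letI := T.instFieldK;
        letI := T.instNumberFieldK; letI := T.instAlgebraK; letI := T.instFieldFbar; letI := T.instAlgebraFbar;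
        letI := T.instAlgebraKFbar; letI := T.instIsElliptic;
      ℤ → ℤ → ∀ j : (thetaIndex (pilotDataOfK T.D T.K)).LabelStar, Set ((logShellsDH (pilotDataOfK T.D T.K) (analyticLogv T.K)).GlobalPacket j.1))
    (unitImage : ∀ (P : NFPoint) (l : ℕ) (T : Cor22.ThetaVolumeDatumAt P l), letI := T.instFieldF; letI := T.instNumberFieldF; letI := T.instAlgebraF; letI := T.instFieldK;
        letI := T.instNumberFieldK; letI := T.instAlgebraK; letI := T.instFieldFbar; letI := T.instAlgebraFbar;
        letI := T.instAlgebraKFbar; letI := T.instIsElliptic;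
      ℤ → ℤ → ℕ → ∀ (j : (thetaIndex (pilotDataOfK T.D T.K)).Label) (vQ : (thetaIndex (pilotDataOfK T.D T.K)).VQ), Set ((logShellsDH (pilotDataOfK T.D T.K) (analyticLogv T.K)).Packet j vQ))
    (ballImage : ∀ (P : NFPoint) (l : ℕ) (T : Cor22.ThetaVolumeDatumAt P l), letI := T.instFieldF; letI := T.instNumberFieldF; letI := T.instAlgebraF; letI := T.instFieldK;
        letI := T.instNumberFieldK; letI := T.instAlgebraK; letI := T.instFieldFbar; letI := T.instAlgebraFbar;
        letI := T.instAlgebraKFbar; letI := T.instIsElliptic;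
      ℤ → ℤ → ∀ (j : (thetaIndex (pilotDataOfK T.D T.K)).Label) (vQ : (thetaIndex (pilotDataOfK T.D T.K)).VQ), Set ((logShellsDH (pilotDataOfK T.D T.K) (analyticLogv T.K)).Packet j vQ))
    (thetaDiv : ∀ (P : NFPoint) (l : ℕ) (T : Cor22.ThetaVolumeDatumAt P l), letI := T.instFieldF; letI := T.instNumberFieldF; letI := T.instAlgebraF; letI := T.instFieldK;
        letI := T.instNumberFieldK; letI := T.instAlgebraK; letI := T.instFieldFbar; letI := T.instAlgebraFbar;
        letI := T.instAlgebraKFbar; letI := T.instIsElliptic;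
      ℤ → ℤ → LgpDivisor (M P l T) (thetaIndex (pilotDataOfK T.D T.K)).lstar)
    (n : ∀ (P : NFPoint) (l : ℕ) (T : Cor22.ThetaVolumeDatumAt P l), ℤ)
    {HT : ∀ (P : NFPoint) (l : ℕ) (T : Cor22.ThetaVolumeDatumAt P l), Type} {LogLink : ∀ (P : NFPoint) (l : ℕ) (T : Cor22.ThetaVolumeDatumAt P l), HT P l T → HT P l T → Type}
    {IsFull : ∀ (P : NFPoint) (l : ℕ) (T : Cor22.ThetaVolumeDatumAt P l), ∀ {s t : HT P l T}, LogLink P l T s t → Prop}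
    (lat : ∀ (P : NFPoint) (l : ℕ) (T : Cor22.ThetaVolumeDatumAt P l), LGPGaussianLogThetaLattice (LogLink P l T) (IsFull P l T))
    {Frd : ∀ (P : NFPoint) (l : ℕ) (T : Cor22.ThetaVolumeDatumAt P l), Type} {IsoF : ∀ (P : NFPoint) (l : ℕ) (T : Cor22.ThetaVolumeDatumAt P l), Frd P l T → Frd P l T → Type} {Ob : ∀ (P : NFPoint) (l : ℕ) (T : Cor22.ThetaVolumeDatumAt P l), Frd P l T → Type}
    {realify : ∀ (P : NFPoint) (l : ℕ) (T : Cor22.ThetaVolumeDatumAt P l), Frd P l T → Frd P l T} {Strip : ∀ (P : NFPoint) (l : ℕ) (T : Cor22.ThetaVolumeDatumAt P l), Type} {IsoS : ∀ (P : NFPoint) (l : ℕ) (T : Cor22.ThetaVolumeDatumAt P l), Strip P l T → Strip P l T → Type}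
    {Mv : ∀ (P : NFPoint) (l : ℕ) (T : Cor22.ThetaVolumeDatumAt P l), letI := T.instFieldF; letI := T.instNumberFieldF; letI := T.instAlgebraF; letI := T.instFieldK;
        letI := T.instNumberFieldK; letI := T.instAlgebraK; letI := T.instFieldFbar; letI := T.instAlgebraFbar;
        letI := T.instAlgebraKFbar; letI := T.instIsElliptic;
      ∀ v : (thetaIndex (pilotDataOfK T.D T.K)).V, v ∈ (thetaIndex (pilotDataOfK T.D T.K)).Vbad → Type}
    [∀ P l T v h, Monoid (Mv P l T v h)]
    (sig : ∀ (P : NFPoint) (l : ℕ) (T : Cor22.ThetaVolumeDatumAt P l), letI := T.instFieldF; letI := T.instNumberFieldF; letI := T.instAlgebraF; letI := T.instFieldK;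
        letI := T.instNumberFieldK; letI := T.instAlgebraK; letI := T.instFieldFbar; letI := T.instAlgebraFbar;
        letI := T.instAlgebraKFbar; letI := T.instIsElliptic;
      GlobalLGPFrobenioidSignature (thetaIndex (pilotDataOfK T.D T.K)).lstar (thetaIndex (pilotDataOfK T.D T.K)).V (· ∈ (thetaIndex (pilotDataOfK T.D T.K)).Vbad) (Frd P l T) (IsoF P l T) (Ob P l T) (realify P l T)
        (Strip P l T) (IsoS P l T) (Mv P l T))
    (split : ∀ (P : NFPoint) (l : ℕ) (T : Cor22.ThetaVolumeDatumAt P l), SplittingMonoids (Mv P l T))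
    {ObΔ : ∀ (P : NFPoint) (l : ℕ) (T : Cor22.ThetaVolumeDatumAt P l), Type} {N : ∀ (P : NFPoint) (l : ℕ) (T : Cor22.ThetaVolumeDatumAt P l), letI := T.instFieldF; letI := T.instNumberFieldF; letI := T.instAlgebraF; letI := T.instFieldK;
        letI := T.instNumberFieldK; letI := T.instAlgebraK; letI := T.instFieldFbar; letI := T.instAlgebraFbar;
        letI := T.instAlgebraKFbar; letI := T.instIsElliptic;
      ∀ v : (thetaIndex (pilotDataOfK T.D T.K)).V, v ∈ (thetaIndex (pilotDataOfK T.D T.K)).Vbad → Type}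
    [∀ P l T v h, Monoid (N P l T v h)] (qData : ∀ (P : NFPoint) (l : ℕ) (T : Cor22.ThetaVolumeDatumAt P l), QPilotData (ObΔ P l T) (N P l T))

/-! ## §2 The statement-line hypotheses are THEOREMS at every genuine datum of a nonarchimedean-Szpiro-good point -/
/-- **The typed [IUTchIII] Cor. 3.12 IN READING (P) HOLDS at every genuine Θ-volume datum of a nonarchimedean-Szpiro-good point** (`λ ∈ U_X`, `l ≥ 1`,
`d_mod ≤ (l+5)/4`, `((l+1)/24 − 1/(2l))·log q^{∤{2,l}}(λ) ≤ ((l+5)/4 − d_mod)·(log-diff(λ) + (1 − 1/l)·log 𝔣^{∤{2,l}}(λ))`): `SlotStatement` of the sharp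
`K`-setting at the CHOSEN realising ideles — LITERALLY the setting term of abc-iut-C-cert-2's `hstPBad` (p458998 / p462946) — by §1 + abc-iut-s2-p2's readout.
An instantiation by theorem on an explicit locus; no side taken elsewhere. [cite: Mochizuki2012, IUTchIII Cor. 3.12 p. 174 l. 16–18] [claim: Mochizuki2012, status: disputed] -/
theorem GenuineKSlot.slotStatement_chosen_of_le_logDiff_logCond {P : NFPoint} {l : ℕ} (T : Cor22.ThetaVolumeDatumAt P l)
    (hU : P.InU) (hl : 0 < l) (hd : (Cor22.dmod P : ℝ) ≤ ((l : ℝ) + 5) / 4)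
    (h : (((l : ℝ) + 1) / 24 - 1 / (2 * l)) * Cor22.logQAvoid P {2, l} ≤
      (((l : ℝ) + 5) / 4 - Cor22.dmod P) * (P.logDiff + (1 - 1 / (l : ℝ)) * Cor22.logCondAvoid P {2, l})) :
    letI := T.instFieldF; letI := T.instNumberFieldF; letI := T.instAlgebraF; letI := T.instFieldK;
        letI := T.instNumberFieldK; letI := T.instAlgebraK; letI := T.instFieldFbar; letI := T.instAlgebraFbar;
        letI := T.instAlgebraKFbar; letI := T.instIsElliptic;
      (settingPrVolSharp (pilotDataOfK T.D T.K) (logvAnalytic_analyticLogv (F := T.K)) (M P l T) (archPk P l T) (archSub P l T) (Ψ P l T)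
          (act P l T) (Mmod P l T) (region P l T) (n P l T) (lat P l T) (sig P l T) (split P l T) (qData P l T)
          (exists_realising_qIdeles_pilotDataOfK T.D).choose
          (exists_realising_thetaIdeles_pilotDataOfK T.D).choose
          (exists_realising_qIdeles_pilotDataOfK T.D).choose_spec.1
          (exists_realising_qIdeles_pilotDataOfK T.D).choose_spec.2.1).SlotStatement := by
  letI := T.instFieldF; letI := T.instNumberFieldF; letI := T.instAlgebraF; letI := T.instFieldK
  letI := T.instNumberFieldK; letI := T.instAlgebraK; letI := T.instFieldFbar; letI := T.instAlgebraFbar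
  letI := T.instAlgebraKFbar; letI := T.instIsElliptic
  exact (slotStatement_settingPrVolSharp_pilotDataOfK_chosen_readout T (M P l T) (archPk P l T) (archSub P l T) (Ψ P l T)
        (act P l T) (Mmod P l T) (region P l T) (n P l T) (lat P l T) (sig P l T) (split P l T) (qData P l T)).1.mpr
    (GenuineContent.cor312PerImageNonarchOf_of_le_logDiff_logCond T hU hl hd h)

/-- **Szpiro form** (`l ≥ 5`, `d_mod ≤ (l+5)/4`): `log q^{∤2l}(λ) ≤ (6l(l+5−4d_mod)/((l+4)(l−3)))·(log-diff(λ) + (1 − 1/l)·log 𝔣^{∤2l}(λ))`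
⟹ `SlotStatement` (sharp `K`-setting, chosen ideles) at every genuine datum of `(P, l)`. NUMBERS (no side): abc-iut-C-cert-2's
`abc_of_slotStatement_genuineK_szpiroBad_read` DEMANDS this proposition exactly at the points with `log q^{∤2l}` ABOVE the same bound
`+ (6l(l+5)/((l+4)(l−3)))·log π` (or `(l+5)/4 < d_mod`): hypothesis locus and theorem locus are separated by the archimedean strip only.
[cite: Mochizuki2012, IUTchIV Thm. 1.10 p. 22–23, Step (vii) p. 30] [claim: Mochizuki2012, status: disputed] -/
theorem GenuineKSlot.slotStatement_chosen_of_szpiroNonarch {P : NFPoint} {l : ℕ} (T : Cor22.ThetaVolumeDatumAt P l)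
    (hU : P.InU) (h5 : 5 ≤ l) (hd : (Cor22.dmod P : ℝ) ≤ ((l : ℝ) + 5) / 4)
    (h : Cor22.logQAvoid P {2, l} ≤
      6 * l * (((l : ℝ) + 5) - 4 * Cor22.dmod P) / (((l : ℝ) + 4) * ((l : ℝ) - 3))
          * (P.logDiff + (1 - 1 / (l : ℝ)) * Cor22.logCondAvoid P {2, l})) :
    letI := T.instFieldF; letI := T.instNumberFieldF; letI := T.instAlgebraF; letI := T.instFieldK;
        letI := T.instNumberFieldK; letI := T.instAlgebraK; letI := T.instFieldFbar; letI := T.instAlgebraFbar;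
        letI := T.instAlgebraKFbar; letI := T.instIsElliptic;
      (settingPrVolSharp (pilotDataOfK T.D T.K) (logvAnalytic_analyticLogv (F := T.K)) (M P l T) (archPk P l T) (archSub P l T) (Ψ P l T)
          (act P l T) (Mmod P l T) (region P l T) (n P l T) (lat P l T) (sig P l T) (split P l T) (qData P l T)
          (exists_realising_qIdeles_pilotDataOfK T.D).choose
          (exists_realising_thetaIdeles_pilotDataOfK T.D).choose
          (exists_realising_qIdeles_pilotDataOfK T.D).choose_spec.1
          (exists_realising_qIdeles_pilotDataOfK T.D).choose_spec.2.1).SlotStatement := by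
  letI := T.instFieldF; letI := T.instNumberFieldF; letI := T.instAlgebraF; letI := T.instFieldK
  letI := T.instNumberFieldK; letI := T.instAlgebraK; letI := T.instFieldFbar; letI := T.instAlgebraFbar
  letI := T.instAlgebraKFbar; letI := T.instIsElliptic
  exact (slotStatement_settingPrVolSharp_pilotDataOfK_chosen_readout T (M P l T) (archPk P l T) (archSub P l T) (Ψ P l T)
        (act P l T) (Mmod P l T) (region P l T) (n P l T) (lat P l T) (sig P l T) (split P l T) (qData P l T)).1.mpr
    (GenuineContent.cor312PerImageNonarchOf_of_szpiroNonarch T hU h5 hd h)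

/-- **… and so does the typed Cor. 3.12 IN READING (U)** (`Statement` of the same setting — LITERALLY the setting term of the (U) statement lines'
`hstBad` / `hstC`, p455513 / p460839 / p461940): abc-iut-s2-p2's junction `SlotStatement → Statement`. [cite: Mochizuki2012, IUTchIII Cor. 3.12 p. 174 l. 16–18] [claim: Mochizuki2012, status: disputed] -/
theorem GenuineKSlot.statement_chosen_of_le_logDiff_logCond {P : NFPoint} {l : ℕ} (T : Cor22.ThetaVolumeDatumAt P l)
    (hU : P.InU) (hl : 0 < l) (hd : (Cor22.dmod P : ℝ) ≤ ((l : ℝ) + 5) / 4)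
    (h : (((l : ℝ) + 1) / 24 - 1 / (2 * l)) * Cor22.logQAvoid P {2, l} ≤
      (((l : ℝ) + 5) / 4 - Cor22.dmod P) * (P.logDiff + (1 - 1 / (l : ℝ)) * Cor22.logCondAvoid P {2, l})) :
    letI := T.instFieldF; letI := T.instNumberFieldF; letI := T.instAlgebraF; letI := T.instFieldK;
        letI := T.instNumberFieldK; letI := T.instAlgebraK; letI := T.instFieldFbar; letI := T.instAlgebraFbar;
        letI := T.instAlgebraKFbar; letI := T.instIsElliptic;
      (settingPrVolSharp (pilotDataOfK T.D T.K) (logvAnalytic_analyticLogv (F := T.K)) (M P l T) (archPk P l T) (archSub P l T) (Ψ P l T)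
          (act P l T) (Mmod P l T) (region P l T) (n P l T) (lat P l T) (sig P l T) (split P l T) (qData P l T)
          (exists_realising_qIdeles_pilotDataOfK T.D).choose
          (exists_realising_thetaIdeles_pilotDataOfK T.D).choose
          (exists_realising_qIdeles_pilotDataOfK T.D).choose_spec.1
          (exists_realising_qIdeles_pilotDataOfK T.D).choose_spec.2.1).Statement := by
  letI := T.instFieldF; letI := T.instNumberFieldF; letI := T.instAlgebraF; letI := T.instFieldK
  letI := T.instNumberFieldK; letI := T.instAlgebraK; letI := T.instFieldFbar; letI := T.instAlgebraFbar
  letI := T.instAlgebraKFbar; letI := T.instIsElliptic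
  exact (slotStatement_settingPrVolSharp_pilotDataOfK_chosen_readout T (M P l T) (archPk P l T) (archSub P l T) (Ψ P l T)
        (act P l T) (Mmod P l T) (region P l T) (n P l T) (lat P l T) (sig P l T) (split P l T) (qData P l T)).2
    (GenuineKSlot.slotStatement_chosen_of_le_logDiff_logCond M archPk archSub Ψ act Mmod region n lat sig split qData T hU hl hd h)

/-! ## §3 Per datum, READ 0: the reading-(P) statement gives the per-image number-level Corollary -/
/-- **Per datum, reading (P), READ 0: `SlotStatement ⟹ T.Cor312PerImageOf`** — abc-iut-C-cert-2's `GenuineKSlot.cor312PerImageOf_of_slotStatement` with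
its READ-P hypothesis discharged by abc-iut-s2-p7's p462377 (converse fails by the archimedean slack; abc-iut-s2-p2's readout). Nothing asserted.
[cite: Mochizuki2012, IUTchIII Cor. 3.12 proof Step (x) p. 181; IUTchIV Thm. 1.10 Step (vii) p. 30] [claim: Mochizuki2012, status: disputed] -/
theorem GenuineKSlot.cor312PerImageOf_of_slotStatement_read {P : NFPoint} {l : ℕ} (T : Cor22.ThetaVolumeDatumAt P l)
    (hst : letI := T.instFieldF; letI := T.instNumberFieldF; letI := T.instAlgebraF; letI := T.instFieldK;
        letI := T.instNumberFieldK; letI := T.instAlgebraK; letI := T.instFieldFbar; letI := T.instAlgebraFbar;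
        letI := T.instAlgebraKFbar; letI := T.instIsElliptic;
      (settingPrVolSharp (pilotDataOfK T.D T.K) (logvAnalytic_analyticLogv (F := T.K)) (M P l T) (archPk P l T) (archSub P l T) (Ψ P l T)
          (act P l T) (Mmod P l T) (region P l T) (n P l T) (lat P l T) (sig P l T) (split P l T) (qData P l T)
          (exists_realising_qIdeles_pilotDataOfK T.D).choose
          (exists_realising_thetaIdeles_pilotDataOfK T.D).choose
          (exists_realising_qIdeles_pilotDataOfK T.D).choose_spec.1
          (exists_realising_qIdeles_pilotDataOfK T.D).choose_spec.2.1).SlotStatement) :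
    T.Cor312PerImageOf :=
  GenuineKSlot.cor312PerImageOf_of_slotStatement M archPk archSub Ψ act Mmod region n lat sig split qData T hst
    (negLogThetaSlot_settingPrVolSharp_pilotDataOfK_chosen_le_datum T (M P l T) (archPk P l T) (archSub P l T) (Ψ P l T)
        (act P l T) (Mmod P l T) (region P l T) (n P l T) (lat P l T) (sig P l T) (split P l T) (qData P l T))

/-! ## §4 The reading-(P) DOWNSTREAM STATEMENT line, θ-cut, READ 0 — explicit 1 -/
/-- **`abc_of_slotStatement_genuineK_content_offLicence_read`** — `ABC` from ONE hypothesis [C312-P, content, off-licence] `hstPOffC` «at every admissible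
`(P, l)` ON THE CONTENT LOCUS of [IUTchIV] Thm. 1.10's display and every genuine `T` there at which OUR slot licence FAILS (sharp `K`-setting, chosen
realising ideles), the typed Cor. 3.12 conclusion IN READING (P), `SlotStatement`» — §3 per datum into abc-iut-C-cert-2's γ-θ certificate with READ 0
`abc_of_slotLicence_orNumP_K_content_read` (p462946). Explicit 1; CONE 0 · READ 0 · PIN 0 · SIDE 0 · S_H 0. WEAKER-OR-EQUAL as a theorem than that
γ-θ certificate (§3 one way only); STRONGER-OR-EQUAL than `…_content_read` below and (content ⟹ Szpiro-bad, abc-iut-C-cert-1 `szpiroBad_of_content`) than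
abc-iut-C-cert-2's `abc_of_slotStatement_genuineK_szpiroBad_read`. «`ABC` follows from this hypothesis as typed» — nothing asserted about it; by §2 it is a
theorem on the nonarch-Szpiro-good locus (disjoint from the content locus) and it is demanded at no known datum. No side taken; typed ≠ proved.
[claim: Mochizuki2012, status: disputed] [cite: Mochizuki2012, IUTchIII Cor. 3.12 p. 174; IUTchIV Thm. 1.10 p. 22–23, Step (viii) p. 30] -/
theorem abc_of_slotStatement_genuineK_content_offLicence_read
    (hstPOffC : ∀ (P : NFPoint), P ∈ UP → ∀ (l : ℕ), l.Prime → 5 ≤ l →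
      Cor22.AdmitsCore P → Cor22.CondP2 P l → Cor22.CondP5 P l → Cor22.CondP6 P l →
      -- ONLY ON THE CONTENT LOCUS of [IUTchIV] Thm 1.10's display (abc-iut-C-cert-1's θ-guard, p459802 / p461361 VERBATIM)
      6 * ((1 + 20 * (Cor22.dmod P : ℝ) / l) * (P.logDiff + Cor22.logCondAvoid P {2, l}))
          + 120 * (2 ^ 12 * 3 ^ 3 * 5 * (Cor22.dmod P : ℝ) * l) < Cor22.logQAvoid P {2, l} →
      ∀ (T : Cor22.ThetaVolumeDatumAt P l), letI := T.instFieldF; letI := T.instNumberFieldF; letI := T.instAlgebraF; letI := T.instFieldK;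
        letI := T.instNumberFieldK; letI := T.instAlgebraK; letI := T.instFieldFbar; letI := T.instAlgebraFbar;
        letI := T.instAlgebraKFbar; letI := T.instIsElliptic;
      ¬ (settingPrVolSharp (pilotDataOfK T.D T.K) (logvAnalytic_analyticLogv (F := T.K)) (M P l T) (archPk P l T) (archSub P l T) (Ψ P l T)
          (act P l T) (Mmod P l T) (region P l T) (n P l T) (lat P l T) (sig P l T) (split P l T) (qData P l T)
          (exists_realising_qIdeles_pilotDataOfK T.D).choose
          (exists_realising_thetaIdeles_pilotDataOfK T.D).choose
          (exists_realising_qIdeles_pilotDataOfK T.D).choose_spec.1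
          (exists_realising_qIdeles_pilotDataOfK T.D).choose_spec.2.1).SlotLicence →
        (settingPrVolSharp (pilotDataOfK T.D T.K) (logvAnalytic_analyticLogv (F := T.K)) (M P l T) (archPk P l T) (archSub P l T) (Ψ P l T)
          (act P l T) (Mmod P l T) (region P l T) (n P l T) (lat P l T) (sig P l T) (split P l T) (qData P l T)
          (exists_realising_qIdeles_pilotDataOfK T.D).choose
          (exists_realising_thetaIdeles_pilotDataOfK T.D).choose
          (exists_realising_qIdeles_pilotDataOfK T.D).choose_spec.1
          (exists_realising_qIdeles_pilotDataOfK T.D).choose_spec.2.1).SlotStatement)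
    : _root_.ABC := by
  refine abc_of_slotLicence_orNumP_K_content_read M archPk archSub Ψ act Mmod region n lat sig split qData ?_
  intro P hP l hl h5 hc h2 h5' h6 hct T hlic
  exact GenuineKSlot.cor312PerImageOf_of_slotStatement_read M archPk archSub Ψ act Mmod region n lat sig split qData T
    (hstPOffC P hP l hl h5 hc h2 h5' h6 hct T hlic)

/-- **`abc_of_slotStatement_genuineK_content_read`** — the θ-cut of abc-iut-C-cert-2's (P) statement line `…_szpiroBad_read` (p462946): `ABC` from ONE
hypothesis [C312-P, content] `hstPC` «`SlotStatement` (sharp `K`-setting, chosen realising ideles) at every admissible `(P, l)` ON THE CONTENT LOCUS and every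
genuine `T`» (`hstPBad` with the Szpiro-bad antecedent REPLACED by abc-iut-C-cert-1's content guard, all else verbatim). Explicit 1; immediate from
`…_content_offLicence_read`. Nothing asserted; no side taken; typed ≠ proved. [claim: Mochizuki2012, status: disputed] [cite: Mochizuki2012, IUTchIII Cor. 3.12 p. 174] -/
theorem abc_of_slotStatement_genuineK_content_read
    (hstPC : ∀ (P : NFPoint), P ∈ UP → ∀ (l : ℕ), l.Prime → 5 ≤ l →
      Cor22.AdmitsCore P → Cor22.CondP2 P l → Cor22.CondP5 P l → Cor22.CondP6 P l →
      -- ONLY ON THE CONTENT LOCUS of [IUTchIV] Thm 1.10's display (abc-iut-C-cert-1's θ-guard, p459802 / p461361 VERBATIM)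
      6 * ((1 + 20 * (Cor22.dmod P : ℝ) / l) * (P.logDiff + Cor22.logCondAvoid P {2, l}))
          + 120 * (2 ^ 12 * 3 ^ 3 * 5 * (Cor22.dmod P : ℝ) * l) < Cor22.logQAvoid P {2, l} →
      ∀ (T : Cor22.ThetaVolumeDatumAt P l), letI := T.instFieldF; letI := T.instNumberFieldF; letI := T.instAlgebraF; letI := T.instFieldK;
        letI := T.instNumberFieldK; letI := T.instAlgebraK; letI := T.instFieldFbar; letI := T.instAlgebraFbar;
        letI := T.instAlgebraKFbar; letI := T.instIsElliptic;
      (settingPrVolSharp (pilotDataOfK T.D T.K) (logvAnalytic_analyticLogv (F := T.K)) (M P l T) (archPk P l T) (archSub P l T) (Ψ P l T)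
          (act P l T) (Mmod P l T) (region P l T) (n P l T) (lat P l T) (sig P l T) (split P l T) (qData P l T)
          (exists_realising_qIdeles_pilotDataOfK T.D).choose
          (exists_realising_thetaIdeles_pilotDataOfK T.D).choose
          (exists_realising_qIdeles_pilotDataOfK T.D).choose_spec.1
          (exists_realising_qIdeles_pilotDataOfK T.D).choose_spec.2.1).SlotStatement)
    : _root_.ABC :=
  abc_of_slotStatement_genuineK_content_offLicence_read M archPk archSub Ψ act Mmod region n lat sig split qData
    (fun P hP l hl h5 hc h2 h5' h6 hct T _ => hstPC P hP l hl h5 hc h2 h5' h6 hct T)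

end Family

end Summit.ABC.IUTFork.Conditional

end
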